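import Summits.BirchSwinnertonDyer.BirchSwinnertonDyer.Theorems.ThetaPartnerAtTwoSignedControlAtTwoPlusKimAmbient
import Summits.BirchSwinnertonDyer.BirchSwinnertonDyer.Theorems.ThetaPartnerAtTwoSignedControlAtTwoPlusKimSignedUnion
import Summits.BirchSwinnertonDyer.BirchSwinnertonDyer.Theorems.ByReductionTypeAtTwoSupersingularFlatLiftAssemblyTop
import Summits.BirchSwinnertonDyer.BirchSwinnertonDyer.Theorems.ByReductionTypeAtTwoSupersingularFlatConjModSelmer
import Summits.BirchSwinnertonDyer.Rank1Residual.X2.GreenbergVatsalSelmerLink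
import HarnessLib

/-!
# The «LIFT» assembly at LEVEL `K` for Kobayashi's `Sel^ε(E/K_∞)`: Greenberg's second diagram (LNM 1716
# pp. 107–108) — «LIFT′ on `H¹(K_Σ/K_∞, E[p^∞])`» ⟸ CASSELS (Prop. 4.13 / p. 122, VERBATIM shape) + the local
# lifts at the FINITE places of `Σ`, the one above `p` carrying Kobayashi's signed clause; hence
# `(Sel^ε(E/K_∞))_γ = 0` and B. D. Kim's «no finite `Λ`-submodule» from (a) ∧ (b) ∧ CASSELS ∧ LOC

Route `ThetaPartnerAtTwo` (TP2; crux shared with `ResidualThetaTransportAtTwo`), crux K4 `SignedControlAtTwo`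
(stmt-BirchSwinnertonDyer-20309), line `eulerchar` v4, stub `stub_plusKimNoFiniteSubmoduleTwo` (KIM⁺@2). Seat
`prover-bsd-wall-tp2-p3-w2` (width seat 2/3). Part 3 of the KIM⁺ series — the `±` twin of the ♭ road's part 7
(`…SupersingularFlatLiftAssemblyTop`, `bsd-2adic-ss-1` GEN 12; its generic §1–§2 — restriction preserves
«unramified outside `Σ`», invariance of restricted classes, the archimedean lift — and the `γ → Γ_K` upgrade
`conjH1_sub_mem_of_conjH1_generator_sub_mem` of `…FlatConjModSelmer` are imported and cited by name). What is new
for `Sel^ε`: Kobayashi's `Sel^ε(E/K_∞)` is the UNION of the images of the layer groups `Sel^ε(E/K_n)` (Def. 1.1),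
so membership of `t − res y` is certified through part 2 (`…PlusKimSignedUnion`): classically Selmer over `K_∞`
+ `Γ_K`-invariant modulo `Sel^ε_∞` + at each `v ∣ p` the class ITSELF is a restricted layer class in the signed
Kummer condition `𝒦^ε_n(v) = localKummerOverOfEmb W p (κ.layerSubgroup n) (closureEmb K_v) (E^ε(K_n·K_v))` — this
last clause is the shape in which the `±` local theory at `p` (LOC^ε@p: `(E^ε(K_{∞,v}) ⊗ ℚ_p/ℤ_p)_Γ = 0`) enters.

WHAT IS PROVED (namespace `…Theorems.SignedEC`; `K : Type` a number field, prime `p`, CYCLOTOMIC `κ`, sign `ε`,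
injective restriction maps `h_n` (e.g. `E(K)[p] = 0`), `Σ₀ ⊇` the bad places prime to `p`):
* §1 `exists_sub_resOfLe_mem_signedSelmerInfty_of_cassels_top` — for `t ∈ H¹(K_Σ/K_∞, E[p^∞])` with
  `conj_σ t − t ∈ Sel^ε_∞` (all `σ`): (CASSELS, displayed: the body of `Greenberg1999.casselsSurjectivity_H1Sigma K`
  after its two premises) ∧ (LOC at the finite `v ∈ Σ₀ ∪ {v ∣ p}`, displayed: a `p`-power-torsion class
  `x_v ∈ H¹(Γ_{K_v}, E(K̄_v))` with «`loc_v y = x_v` ⇒ `t − res y` classically Kummer at the chosen place above `v`,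
  and for `v ∣ p` a restricted `𝒦^ε_n(v)`-class») ⇒ `t − res y ∈ Sel^ε(E/K_∞)` for some `y ∈ H¹(Γ_K, E[p^∞])`.
  Off `Σ`: `conj_σ t` and `res y` are unramified, hence Kummer over the cyclotomic tower
  (`GreenbergVatsalUnramifiedAway.unramKer_le_localKerOver_of_isCyclotomic`); at `∞`: the ♭ road's archimedean lift.
* §2 `signedSelmerInfty_le_unramifiedOutside` — `Sel^ε(E/K_∞) ⊆ H¹(K_Σ/K_∞, E[p^∞])` (AEC X.4.4 =
  `GreenbergVatsalSelmerLink.localKerOver_le_unramKer`); `signedEndCoinvariants_subsingleton_of_cassels_top` —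
  **(a) ∧ (b) for `H¹(K_Σ/K_∞, E[p^∞])` ∧ CASSELS ∧ LOC ⇒ `(Sel^ε(E/K_∞))_γ = 0`** (topological generator `γ`);
  `signed_forall_noFiniteSubmodule_of_cassels_top` — **⇒ every Pontryagin-dual datum `D` of `Sel^ε(E/K_∞)` has no
  nonzero finite `Λ`-submodule** (B. D. Kim 2013 Thm. 1.1's shape).
HONEST FRAMING: THEOREMS ONLY (no definition, no named fact, no `sorry`), route-independent; (a), (b), CASSELS and
the finite local lifts are displayed hypotheses, NOT proved here; nothing about any curve is asserted; closes no
item by itself; BSD is not proved by any of this.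

References: [GreenbergLNM1716] §3 p. 86, §4 p. 104, Lemma 4.7 pp. 107–108, Prop. 4.12, Prop. 4.13 and p. 122,
p. 119; [Kobayashi2003] Def. 1.1; [BDKim2013] Thm. 1.1, Thm. 3.14, proof of Cor. 3.15; [GreenbergVatsal2000] §2
pp. 16–17; [Cassels1964ArithmeticVII]; [SilvermanAEC2009] Cor. X.4.4.
-/

set_option autoImplicit false
-- the Theorems namespace of this sub repeats the summit name by design (D-0017 nested layout)
set_option linter.dupNamespace false

noncomputable section

open scoped Classical NumberField

open NumberField IsDedekindDomain

namespace Summit.BirchSwinnertonDyer.BirchSwinnertonDyer.Theorems.SignedEC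

open Literature.NumberTheory.EllipticCurves Literature.NumberTheory.GaloisRepresentations
  WeierstrassCurve ZpExtension Literature.NumberTheory.EllipticCurves.Kobayashi2003
  Literature.NumberTheory.EllipticCurves.IwasawaDual Literature.NumberTheory.EllipticCurves.IwasawaAlgebra
  Literature.NumberTheory.EllipticCurves.GreenbergVatsal2000
  Summit.BirchSwinnertonDyer.Rank1Residual.X2

-- `K : Type` (universe `0`): the cyclotomic lemmas of `X2.GreenbergVatsalUnramifiedAway` are stated there.
variable {K : Type} [Field K] [NumberField K] (W : WeierstrassCurve K) [W.IsElliptic] {p : ℕ} [Fact p.Prime]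
  (κ : ZpExtension K p) (ε : ℤˣ)

/-! ## §1 The assembly at level `Γ_K` -/

/-- **The «LIFT» assembly at level `Γ_K` (Greenberg, LNM 1716 pp. 107–108) for Kobayashi's `Sel^ε(E/K_∞)`.**
`κ` the CYCLOTOMIC `ℤ_p`-extension of the number field `K`, the restriction maps `h_n` injective, `Σ₀` finite places
off which (and off `p`) `E` has good reduction. Let `t ∈ H¹(K_Σ/K_∞, E[p^∞])` with `conj_σ t − t ∈ Sel^ε_∞` for all
`σ`. Assume (CASSELS) every family of `p`-power-torsion local classes `(x_v)_{v ∈ Σ₀ ∪ {v∣p}}`, `(x_w)_{w∣∞}` is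
realised by some `y ∈ H¹(K_Σ/K, E[p^∞])` (Greenberg p. 122: the cokernel of
`H¹(F_Σ/F, E[p^∞]) → ∏_{v∈Σ} H¹(F_v, E[p^∞])/Im κ_v` is `E(F)_p^`, `= 0` here), and (LOC) at every finite
`v ∈ Σ₀ ∪ {v∣p}` some `p`-power-torsion `x_v ∈ H¹(Γ_{K_v}, E(K̄_v))` has «`loc_v y = x_v` ⇒ `t − res y` classically
Kummer at the chosen place above `v`, and for `v ∣ p` moreover `t − res y = h_n d` with `d` in Kobayashi's signed
Kummer condition `𝒦^ε_n(v)`». Then `t − res y ∈ Sel^ε(E/K_∞)` for some `y ∈ H¹(Γ_K, E[p^∞])`: off `Σ` both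
`conj_σ t` and `res y` are unramified, hence Kummer over the cyclotomic tower; at `∞` the archimedean lift of the
♭ road; the signed membership by part 2's common-layer criterion.
[cite: GreenbergLNM1716, §4 Lemma 4.7 (pp. 107–108), p. 104 and p. 122 (Cassels)] [cite: Kobayashi2003, Def. 1.1]
[cite: BDKim2013, proof of Cor. 3.15 (p. 199)] -/
theorem exists_sub_resOfLe_mem_signedSelmerInfty_of_cassels_top (hκ : κ.IsCyclotomic)
    (hinjh : ∀ n, Function.Injective (W.layerToInfty κ n)) (S₀ : Set (HeightOneSpectrum (𝓞 K)))
    (hgood : ∀ v : HeightOneSpectrum (𝓞 K), v ∉ S₀ → ((p : ℕ) : 𝓞 K) ∉ v.asIdeal →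
      W.HasGoodReductionAt v)
    {t : W.subgroupH1 p κ.kerSubgroup}
    (htH : t ∈ unramifiedOutside κ.kerSubgroup (W.geomPrimaryTorsion p) p S₀)
    (ht : ∀ σ : Field.absoluteGaloisGroup K, W.conjH1 p κ.kerSubgroup σ t - t ∈ signedSelmerInfty W κ ε)
    (hCas : ∀ (x : ∀ v : HeightOneSpectrum (𝓞 K),
        discreteH1 (localSubgroup (⊤ : Subgroup (Field.absoluteGaloisGroup K)) (v.adicCompletion K))
          (localPoints W (v.adicCompletion K)))
      (xi : ∀ w : InfinitePlace K,
        discreteH1 (localSubgroup (⊤ : Subgroup (Field.absoluteGaloisGroup K)) w.Completion)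
          (localPoints W w.Completion)),
      (∀ v, ∃ k : ℕ, p ^ k • x v = 0) → (∀ w, ∃ k : ℕ, p ^ k • xi w = 0) →
      ∃ y : W.subgroupH1 p (⊤ : Subgroup (Field.absoluteGaloisGroup K)),
        y ∈ unramifiedOutside (⊤ : Subgroup (Field.absoluteGaloisGroup K)) (W.geomPrimaryTorsion p) p S₀ ∧
        (∀ v, (v ∈ S₀ ∨ ((p : ℕ) : 𝓞 K) ∈ v.asIdeal) →
          W.localResOver p ⊤ (v.adicCompletion K) y = x v) ∧
        (∀ w, W.localResOver p ⊤ w.Completion y = xi w))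
    (hloc : ∀ v : HeightOneSpectrum (𝓞 K), (v ∈ S₀ ∨ ((p : ℕ) : 𝓞 K) ∈ v.asIdeal) →
      ∃ xv : discreteH1 (localSubgroup (⊤ : Subgroup (Field.absoluteGaloisGroup K)) (v.adicCompletion K))
          (localPoints W (v.adicCompletion K)),
        (∃ k : ℕ, p ^ k • xv = 0) ∧
        ∀ y : W.subgroupH1 p (⊤ : Subgroup (Field.absoluteGaloisGroup K)),
          W.localResOver p ⊤ (v.adicCompletion K) y = xv →
          t - W.resOfLe p (le_top : κ.kerSubgroup ≤ ⊤) y ∈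
              W.localKerOver p κ.kerSubgroup (v.adicCompletion K) ∧
          ((p : 𝓞 K) ∈ v.asIdeal → ∃ (n : ℕ) (d : W.subgroupH1 p (κ.layerSubgroup n)),
            d ∈ localKummerOverOfEmb W p (κ.layerSubgroup n) (closureEmb (K := K) (v.adicCompletion K))
              (signedLocalPoints κ (v.adicCompletion K) W ε n) ∧
            W.layerToInfty κ n d = t - W.resOfLe p (le_top : κ.kerSubgroup ≤ ⊤) y)) :
    ∃ y : W.subgroupH1 p (⊤ : Subgroup (Field.absoluteGaloisGroup K)),
      t - W.resOfLe p (le_top : κ.kerSubgroup ≤ ⊤) y ∈ signedSelmerInfty W κ ε := by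
  -- adapted from the ♭ road's `SSFlatEC.exists_sub_resOfLe_mem_sharpFlatSelmerInfty_of_cassels_top`
  -- local classes to prescribe: the chosen lifts on `Σ₀ ∪ {v ∣ p}` (anything, say `0`, elsewhere), and
  -- the archimedean lifts of the ♭ road's §2
  let x : ∀ v : HeightOneSpectrum (𝓞 K),
      discreteH1 (localSubgroup (⊤ : Subgroup (Field.absoluteGaloisGroup K)) (v.adicCompletion K))
        (localPoints W (v.adicCompletion K)) := fun v ↦
    if h : (v ∈ S₀ ∨ ((p : ℕ) : 𝓞 K) ∈ v.asIdeal) then Classical.choose (hloc v h) else 0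
  have hx_of : ∀ v (h : v ∈ S₀ ∨ ((p : ℕ) : 𝓞 K) ∈ v.asIdeal), x v = Classical.choose (hloc v h) :=
    fun v h ↦ dif_pos h
  have hx_tor : ∀ v, ∃ k : ℕ, p ^ k • x v = 0 := fun v ↦ by
    by_cases h : (v ∈ S₀ ∨ ((p : ℕ) : 𝓞 K) ∈ v.asIdeal)
    · rw [hx_of v h]; exact (Classical.choose_spec (hloc v h)).1
    · rw [show x v = 0 from dif_neg h]; exact ⟨0, smul_zero _⟩
  have hinf := fun w ↦ SSFlatEC.exists_localLift_infinitePlace_top W κ w t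
  let xi : ∀ w : InfinitePlace K,
      discreteH1 (localSubgroup (⊤ : Subgroup (Field.absoluteGaloisGroup K)) w.Completion)
        (localPoints W w.Completion) := fun w ↦ Classical.choose (hinf w)
  obtain ⟨y, hyH, hyfin, hyinf⟩ := hCas x xi hx_tor (fun w ↦ (Classical.choose_spec (hinf w)).1)
  refine ⟨y, ?_⟩
  have hsplit : ∀ σ : Field.absoluteGaloisGroup K,
      W.conjH1 p κ.kerSubgroup σ (t - W.resOfLe p (le_top : κ.kerSubgroup ≤ ⊤) y) =
        (W.conjH1 p κ.kerSubgroup σ t - t) + (t - W.resOfLe p (le_top : κ.kerSubgroup ≤ ⊤) y) := fun σ ↦ by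
    rw [map_sub, SSFlatEC.conjH1_resOfLe_top W κ σ y]; abel
  have hsel' : ∀ σ, (∀ (v : HeightOneSpectrum (𝓞 K)) (τ : Field.absoluteGaloisGroup K),
      W.conjH1 p κ.kerSubgroup τ (W.conjH1 p κ.kerSubgroup σ t - t) ∈
        W.localKerOver p κ.kerSubgroup (v.adicCompletion K)) ∧
      ∀ (w : InfinitePlace K) (τ : Field.absoluteGaloisGroup K),
        W.conjH1 p κ.kerSubgroup τ (W.conjH1 p κ.kerSubgroup σ t - t) ∈
          W.localKerOver p κ.kerSubgroup w.Completion := fun σ ↦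
    (W.mem_selmerGroupOver_iff p κ.kerSubgroup _).mp (signedSelmerInfty_le_selmerInfty W κ ε (ht σ))
  have hone : ∀ {A : AddSubgroup (W.subgroupH1 p κ.kerSubgroup)} {s : W.subgroupH1 p κ.kerSubgroup},
      W.conjH1 p κ.kerSubgroup 1 s ∈ A → s ∈ A := fun {A s} h ↦ by
    rwa [W.conjH1_one_holds p κ.kerSubgroup, AddMonoidHom.id_apply] at h
  have hSig : ∀ v : HeightOneSpectrum (𝓞 K), (v ∈ S₀ ∨ ((p : ℕ) : 𝓞 K) ∈ v.asIdeal) →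
      t - W.resOfLe p (le_top : κ.kerSubgroup ≤ ⊤) y ∈ W.localKerOver p κ.kerSubgroup (v.adicCompletion K) ∧
      ((p : 𝓞 K) ∈ v.asIdeal → ∃ (n : ℕ) (d : W.subgroupH1 p (κ.layerSubgroup n)),
        d ∈ localKummerOverOfEmb W p (κ.layerSubgroup n) (closureEmb (K := K) (v.adicCompletion K))
          (signedLocalPoints κ (v.adicCompletion K) W ε n) ∧
        W.layerToInfty κ n d = t - W.resOfLe p (le_top : κ.kerSubgroup ≤ ⊤) y) := fun v h ↦
    (Classical.choose_spec (hloc v h)).2 y (by rw [hyfin v h, hx_of v h])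
  -- `res y ∈ H¹(K_Σ/K_∞, E[p^∞])`
  have hyH' : W.resOfLe p (le_top : κ.kerSubgroup ≤ ⊤) y ∈
      unramifiedOutside κ.kerSubgroup (W.geomPrimaryTorsion p) p S₀ :=
    SSFlatEC.resOfLe_mem_unramifiedOutside (W.geomPrimaryTorsion p) (le_top : κ.kerSubgroup ≤ ⊤) p S₀ hyH
  -- (i) classically Selmer over `K_∞`
  have hsel : t - W.resOfLe p (le_top : κ.kerSubgroup ≤ ⊤) y ∈ W.selmerInfty κ := by
    refine (W.mem_selmerGroupOver_iff p κ.kerSubgroup _).mpr ⟨fun v σ ↦ ?_, fun w σ ↦ ?_⟩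
    · rw [hsplit σ]
      refine AddSubgroup.add_mem _ (hone ((hsel' σ).1 v 1)) ?_
      by_cases h : (v ∈ S₀ ∨ ((p : ℕ) : 𝓞 K) ∈ v.asIdeal)
      · exact (hSig v h).1
      · obtain ⟨hv, hpv⟩ := not_or.mp h
        have h1 : W.conjH1 p κ.kerSubgroup 1 t ∈ W.localKerOver p κ.kerSubgroup (v.adicCompletion K) :=
          GreenbergVatsalUnramifiedAway.unramKer_le_localKerOver_of_isCyclotomic (κ := κ) (v := v)
            (W := W) (p := p) hκ (hgood v hv hpv) hpv ((mem_unramifiedOutside_iff t).mp htH v hv hpv 1)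
        have h2 : W.conjH1 p κ.kerSubgroup 1 (W.resOfLe p (le_top : κ.kerSubgroup ≤ ⊤) y) ∈
            W.localKerOver p κ.kerSubgroup (v.adicCompletion K) :=
          GreenbergVatsalUnramifiedAway.unramKer_le_localKerOver_of_isCyclotomic (κ := κ) (v := v)
            (W := W) (p := p) hκ (hgood v hv hpv) hpv ((mem_unramifiedOutside_iff _).mp hyH' v hv hpv 1)
        exact AddSubgroup.sub_mem _ (hone h1) (hone h2)
    · rw [hsplit σ]
      refine AddSubgroup.add_mem _ (hone ((hsel' σ).2 w 1)) ?_
      exact (Classical.choose_spec (hinf w)).2 y (hyinf w)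
  -- (ii) `Γ_K`-invariant modulo `Sel^ε_∞`
  have hsub : ∀ σ : Field.absoluteGaloisGroup K,
      W.conjH1 p κ.kerSubgroup σ (t - W.resOfLe p (le_top : κ.kerSubgroup ≤ ⊤) y) -
        (t - W.resOfLe p (le_top : κ.kerSubgroup ≤ ⊤) y) ∈ signedSelmerInfty W κ ε := fun σ ↦ by
    rw [hsplit σ, add_sub_cancel_right]
    exact ht σ
  -- (iii) at each `v ∣ p`: a restricted signed-Kummer layer class; conclude by part 2
  exact mem_signedSelmerInfty_of_conjH1_sub_mem_of_exists_signedKummerLayer W κ ε hinjh hsel hsub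
    fun v hv ↦ (hSig v (Or.inr (by exact_mod_cast hv))).2 hv

/-! ## §2 `(Sel^ε(E/K_∞))_γ = 0` and KIM's shape from (a) ∧ (b) ∧ CASSELS ∧ LOC -/

/-- **`Sel^ε(E/K_∞) ⊆ H¹(K_Σ/K_∞, E[p^∞])`** for `Σ₀ ⊇` the bad places prime to `p`: `Sel^ε_∞ ≤ Sel_∞`
(`signedSelmerInfty_le_selmerInfty`) and the classical Kummer condition at a good `v ∤ p` is unramified
(Silverman AEC X.4.4 = tree `GreenbergVatsalSelmerLink.localKerOver_le_unramKer`, at every conjugate).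
[cite: SilvermanAEC2009, Cor. X.4.4] [cite: GreenbergVatsal2000, §2 pp. 16–17] -/
theorem signedSelmerInfty_le_unramifiedOutside (S₀ : Set (HeightOneSpectrum (𝓞 K)))
    (hgood : ∀ v : HeightOneSpectrum (𝓞 K), v ∉ S₀ → ((p : ℕ) : 𝓞 K) ∉ v.asIdeal → W.HasGoodReductionAt v) :
    signedSelmerInfty W κ ε ≤ unramifiedOutside κ.kerSubgroup (W.geomPrimaryTorsion p) p S₀ := by
  intro s hs
  rw [mem_unramifiedOutside_iff]
  intro v hv hpv σ
  have h := ((W.mem_selmerGroupOver_iff p κ.kerSubgroup _).mp (signedSelmerInfty_le_selmerInfty W κ ε hs)).1 v σ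
  exact GreenbergVatsalSelmerLink.localKerOver_le_unramKer (W := W) (p := p) (H := κ.kerSubgroup)
    (hgood v hv hpv) hpv h

/-- **`(Sel^ε(E/K_∞))_γ = 0` from: (a) ∧ (b) for `H¹(K_Σ/K_∞, E[p^∞])`, CASSELS at level `Γ_K`, and the local
lifts at the finite places of `Σ` (signed clause above `p`)** — cyclotomic `κ`, topological generator `γ`,
injective `h_n`. The `γ`-to-`Γ_K` upgrade is the ♭ road's `conjH1_sub_mem_of_conjH1_generator_sub_mem`, the chase is
part 1's `signedEndCoinvariants_subsingleton_of_ambient_noFinite` with the invariant class `res y` of §1.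
[cite: GreenbergLNM1716, §4 pp. 104, 107–109, 119, 122] [cite: BDKim2013, Thm. 3.14 and proof of Cor. 3.15] -/
theorem signedEndCoinvariants_subsingleton_of_cassels_top (hκ : κ.IsCyclotomic)
    (hinjh : ∀ n, Function.Injective (W.layerToInfty κ n))
    {γ : Field.absoluteGaloisGroup K} (hγ : κ.IsTopGenerator γ) (S₀ : Set (HeightOneSpectrum (𝓞 K)))
    (hgood : ∀ v : HeightOneSpectrum (𝓞 K), v ∉ S₀ → ((p : ℕ) : 𝓞 K) ∉ v.asIdeal →
      W.HasGoodReductionAt v)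
    {Y : Type*} [AddCommGroup Y] [Module (IwasawaAlgebra p) Y]
    (dY : Y →+ (unramifiedOutside κ.kerSubgroup (W.geomPrimaryTorsion p) p S₀ →+ AddCircle (1 : ℚ)))
    (hbij : Function.Bijective dY)
    (hT : ∀ (y : Y) (x : unramifiedOutside κ.kerSubgroup (W.geomPrimaryTorsion p) p S₀),
      dY ((PowerSeries.X : IwasawaAlgebra p) • y) x =
        dY y ⟨W.conjH1 p κ.kerSubgroup γ x,
          conjH1_mem_unramifiedOutside κ.kerSubgroup (W.geomPrimaryTorsion p) p _ γ x.2⟩ - dY y x)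
    (hC : ∀ (a : ℤ_[p]) (y : Y) (x : unramifiedOutside κ.kerSubgroup (W.geomPrimaryTorsion p) p S₀)
      (k : ℕ), (p ^ k) • x = 0 → dY (PowerSeries.C a • y) x = (PadicInt.toZModPow k a).val • dY y x)
    (hY : ∀ N : Submodule (IwasawaAlgebra p) Y, Finite N → N = ⊥)
    (hfin : Finite (invariants p Y))
    (hCas : ∀ (x : ∀ v : HeightOneSpectrum (𝓞 K),
        discreteH1 (localSubgroup (⊤ : Subgroup (Field.absoluteGaloisGroup K)) (v.adicCompletion K))
          (localPoints W (v.adicCompletion K)))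
      (xi : ∀ w : InfinitePlace K,
        discreteH1 (localSubgroup (⊤ : Subgroup (Field.absoluteGaloisGroup K)) w.Completion)
          (localPoints W w.Completion)),
      (∀ v, ∃ k : ℕ, p ^ k • x v = 0) → (∀ w, ∃ k : ℕ, p ^ k • xi w = 0) →
      ∃ y : W.subgroupH1 p (⊤ : Subgroup (Field.absoluteGaloisGroup K)),
        y ∈ unramifiedOutside (⊤ : Subgroup (Field.absoluteGaloisGroup K)) (W.geomPrimaryTorsion p) p S₀ ∧
        (∀ v, (v ∈ S₀ ∨ ((p : ℕ) : 𝓞 K) ∈ v.asIdeal) →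
          W.localResOver p ⊤ (v.adicCompletion K) y = x v) ∧
        (∀ w, W.localResOver p ⊤ w.Completion y = xi w))
    (hloc : ∀ t ∈ unramifiedOutside κ.kerSubgroup (W.geomPrimaryTorsion p) p S₀,
      (∀ σ : Field.absoluteGaloisGroup K, W.conjH1 p κ.kerSubgroup σ t - t ∈ signedSelmerInfty W κ ε) →
      ∀ v : HeightOneSpectrum (𝓞 K), (v ∈ S₀ ∨ ((p : ℕ) : 𝓞 K) ∈ v.asIdeal) →
      ∃ xv : discreteH1 (localSubgroup (⊤ : Subgroup (Field.absoluteGaloisGroup K)) (v.adicCompletion K))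
          (localPoints W (v.adicCompletion K)),
        (∃ k : ℕ, p ^ k • xv = 0) ∧
        ∀ y : W.subgroupH1 p (⊤ : Subgroup (Field.absoluteGaloisGroup K)),
          W.localResOver p ⊤ (v.adicCompletion K) y = xv →
          t - W.resOfLe p (le_top : κ.kerSubgroup ≤ ⊤) y ∈
              W.localKerOver p κ.kerSubgroup (v.adicCompletion K) ∧
          ((p : 𝓞 K) ∈ v.asIdeal → ∃ (n : ℕ) (d : W.subgroupH1 p (κ.layerSubgroup n)),
            d ∈ localKummerOverOfEmb W p (κ.layerSubgroup n) (closureEmb (K := K) (v.adicCompletion K))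
              (signedLocalPoints κ (v.adicCompletion K) W ε n) ∧
            W.layerToInfty κ n d = t - W.resOfLe p (le_top : κ.kerSubgroup ≤ ⊤) y)) :
    Subsingleton (EndCoinvariants (conjSignedSelmerInfty W κ ε γ - 1)) := by
  refine signedEndCoinvariants_subsingleton_of_ambient_noFinite W κ ε γ hγ
    (unramifiedOutside κ.kerSubgroup (W.geomPrimaryTorsion p) p S₀)
    (fun x hx ↦ conjH1_mem_unramifiedOutside κ.kerSubgroup (W.geomPrimaryTorsion p) p _ γ hx)
    (signedSelmerInfty_le_unramifiedOutside W κ ε S₀ hgood) dY hbij hT hC hY hfin fun t htH htγ ↦ ?_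
  have htall : ∀ σ : Field.absoluteGaloisGroup K, W.conjH1 p κ.kerSubgroup σ t - t ∈ signedSelmerInfty W κ ε :=
    SSFlatEC.conjH1_sub_mem_of_conjH1_generator_sub_mem W κ hγ _
      (fun σ s hs ↦ conjH1_mem_signedSelmerInfty W κ ε σ hs) htγ
  obtain ⟨y, hy⟩ := exists_sub_resOfLe_mem_signedSelmerInfty_of_cassels_top W κ ε hκ hinjh S₀ hgood htH
    htall hCas (hloc t htH htall)
  exact ⟨W.resOfLe p (le_top : κ.kerSubgroup ≤ ⊤) y, SSFlatEC.conjH1_resOfLe_top W κ γ y, hy⟩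

/-- **B. D. Kim's Thm. 1.1 / 3.14 shape from (a) ∧ (b) ∧ CASSELS ∧ LOC**: under the hypotheses of
`signedEndCoinvariants_subsingleton_of_cassels_top`, every Pontryagin-dual datum `D` of `Sel^ε(E/K_∞)` (w.r.t. `γ`)
has no nonzero finite `Λ`-submodule (`(Sel^ε_∞)_γ = 0`, then part 1 / the landed
`signed_forall_finite_eq_bot_of_endCoinvariants_subsingleton`). [cite: BDKim2013, Thm. 1.1 and Thm. 3.14]
[cite: GreenbergLNM1716, §4 Prop. 4.12, Prop. 4.13, Lemma 4.7, p. 119] -/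
theorem signed_forall_noFiniteSubmodule_of_cassels_top (hκ : κ.IsCyclotomic)
    (hinjh : ∀ n, Function.Injective (W.layerToInfty κ n))
    {γ : Field.absoluteGaloisGroup K} (hγ : κ.IsTopGenerator γ) (S₀ : Set (HeightOneSpectrum (𝓞 K)))
    (hgood : ∀ v : HeightOneSpectrum (𝓞 K), v ∉ S₀ → ((p : ℕ) : 𝓞 K) ∉ v.asIdeal →
      W.HasGoodReductionAt v)
    {Y : Type*} [AddCommGroup Y] [Module (IwasawaAlgebra p) Y]
    (dY : Y →+ (unramifiedOutside κ.kerSubgroup (W.geomPrimaryTorsion p) p S₀ →+ AddCircle (1 : ℚ)))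
    (hbij : Function.Bijective dY)
    (hT : ∀ (y : Y) (x : unramifiedOutside κ.kerSubgroup (W.geomPrimaryTorsion p) p S₀),
      dY ((PowerSeries.X : IwasawaAlgebra p) • y) x =
        dY y ⟨W.conjH1 p κ.kerSubgroup γ x,
          conjH1_mem_unramifiedOutside κ.kerSubgroup (W.geomPrimaryTorsion p) p _ γ x.2⟩ - dY y x)
    (hC : ∀ (a : ℤ_[p]) (y : Y) (x : unramifiedOutside κ.kerSubgroup (W.geomPrimaryTorsion p) p S₀)
      (k : ℕ), (p ^ k) • x = 0 → dY (PowerSeries.C a • y) x = (PadicInt.toZModPow k a).val • dY y x)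
    (hY : ∀ N : Submodule (IwasawaAlgebra p) Y, Finite N → N = ⊥)
    (hfin : Finite (invariants p Y))
    (hCas : ∀ (x : ∀ v : HeightOneSpectrum (𝓞 K),
        discreteH1 (localSubgroup (⊤ : Subgroup (Field.absoluteGaloisGroup K)) (v.adicCompletion K))
          (localPoints W (v.adicCompletion K)))
      (xi : ∀ w : InfinitePlace K,
        discreteH1 (localSubgroup (⊤ : Subgroup (Field.absoluteGaloisGroup K)) w.Completion)
          (localPoints W w.Completion)),
      (∀ v, ∃ k : ℕ, p ^ k • x v = 0) → (∀ w, ∃ k : ℕ, p ^ k • xi w = 0) →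
      ∃ y : W.subgroupH1 p (⊤ : Subgroup (Field.absoluteGaloisGroup K)),
        y ∈ unramifiedOutside (⊤ : Subgroup (Field.absoluteGaloisGroup K)) (W.geomPrimaryTorsion p) p S₀ ∧
        (∀ v, (v ∈ S₀ ∨ ((p : ℕ) : 𝓞 K) ∈ v.asIdeal) →
          W.localResOver p ⊤ (v.adicCompletion K) y = x v) ∧
        (∀ w, W.localResOver p ⊤ w.Completion y = xi w))
    (hloc : ∀ t ∈ unramifiedOutside κ.kerSubgroup (W.geomPrimaryTorsion p) p S₀,
      (∀ σ : Field.absoluteGaloisGroup K, W.conjH1 p κ.kerSubgroup σ t - t ∈ signedSelmerInfty W κ ε) →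
      ∀ v : HeightOneSpectrum (𝓞 K), (v ∈ S₀ ∨ ((p : ℕ) : 𝓞 K) ∈ v.asIdeal) →
      ∃ xv : discreteH1 (localSubgroup (⊤ : Subgroup (Field.absoluteGaloisGroup K)) (v.adicCompletion K))
          (localPoints W (v.adicCompletion K)),
        (∃ k : ℕ, p ^ k • xv = 0) ∧
        ∀ y : W.subgroupH1 p (⊤ : Subgroup (Field.absoluteGaloisGroup K)),
          W.localResOver p ⊤ (v.adicCompletion K) y = xv →
          t - W.resOfLe p (le_top : κ.kerSubgroup ≤ ⊤) y ∈
              W.localKerOver p κ.kerSubgroup (v.adicCompletion K) ∧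
          ((p : 𝓞 K) ∈ v.asIdeal → ∃ (n : ℕ) (d : W.subgroupH1 p (κ.layerSubgroup n)),
            d ∈ localKummerOverOfEmb W p (κ.layerSubgroup n) (closureEmb (K := K) (v.adicCompletion K))
              (signedLocalPoints κ (v.adicCompletion K) W ε n) ∧
            W.layerToInfty κ n d = t - W.resOfLe p (le_top : κ.kerSubgroup ≤ ⊤) y))
    (D : SignedSelmerDualData W κ γ ε) :
    ∀ N : Submodule (IwasawaAlgebra p) D.X, Finite N → N = ⊥ := by
  haveI := signedEndCoinvariants_subsingleton_of_cassels_top W κ ε hκ hinjh hγ S₀ hgood dY hbij hT hC hY hfin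
    hCas hloc
  exact signed_forall_finite_eq_bot_of_endCoinvariants_subsingleton D hγ

end Summit.BirchSwinnertonDyer.BirchSwinnertonDyer.Theorems.SignedEC

end
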